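import Literature.AlgebraicGeometry.Shioda1982.StandardQuadrupleGoodPrime
import Literature.AlgebraicGeometry.Shioda1982.ExceptionalQuadruplesCompleteLeOneHundredEighty
import Literature.AlgebraicGeometry.Shioda1982.StandardQuadruplePrimePower
import Literature.AlgebraicGeometry.Shioda1982.ExceptionalQuadruplesSweepOneHundredEightyNine
import Literature.AlgebraicGeometry.Shioda1982.ExceptionalQuadruplesSweepOneHundredNinetyTwo
import Literature.AlgebraicGeometry.Shioda1982.ExceptionalQuadruplesSweepTwoHundredTen
import Literature.AlgebraicGeometry.Shioda1982.ExceptionalQuadruplesSweepTwoHundredSixteen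
import Literature.AlgebraicGeometry.Shioda1982.ExceptionalQuadruplesSweepTwoHundredTwentyFour
import Literature.AlgebraicGeometry.Shioda1982.ExceptionalQuadruplesSweepTwoHundredForty
import Literature.AlgebraicGeometry.Shioda1982.ExceptionalQuadruplesSweepTwoHundredFiftyTwo
import Literature.AlgebraicGeometry.Shioda1982.ExceptionalQuadruplesSweepTwoHundredSeventy
import Literature.AlgebraicGeometry.Shioda1982.ExceptionalQuadruplesSweepTwoHundredEighty
import Literature.AlgebraicGeometry.Shioda1982.ExceptionalQuadruplesSweepTwoHundredEightyEight
import Literature.AlgebraicGeometry.Shioda1982.ExceptionalQuadruplesSweepThreeHundredFifteen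
import Literature.AlgebraicGeometry.Shioda1982.ExceptionalQuadruplesSweepThreeHundredTwenty
import Literature.AlgebraicGeometry.Shioda1982.ExceptionalQuadruplesSweepThreeHundredTwentyFour
import Literature.AlgebraicGeometry.Shioda1982.ExceptionalQuadruplesSweepThreeHundredThirtySix
import Literature.AlgebraicGeometry.Shioda1982.ExceptionalQuadruplesSweepThreeHundredSixty
import Literature.AlgebraicGeometry.Shioda1982.ExceptionalQuadruplesSweepThreeHundredSeventyEight
import Literature.AlgebraicGeometry.Shioda1982.ExceptionalQuadruplesSweepThreeHundredEightyFour
import Literature.AlgebraicGeometry.Shioda1982.ExceptionalQuadruplesSweepFourHundredFive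
import Literature.AlgebraicGeometry.Shioda1982.ExceptionalQuadruplesSweepFourHundredTwenty
import Literature.AlgebraicGeometry.Shioda1982.ExceptionalQuadruplesSweepFourHundredThirtyTwo
import Literature.AlgebraicGeometry.Shioda1982.ExceptionalQuadruplesSweepFourHundredFortyEight
import Literature.AlgebraicGeometry.Shioda1982.ExceptionalQuadruplesSweepFourHundredEighty
import Literature.AlgebraicGeometry.Shioda1982.ExceptionalQuadruplesSweepFourHundredEightySix
import Literature.AlgebraicGeometry.Shioda1982.ExceptionalQuadruplesSweepFiveHundredFour
import Literature.AlgebraicGeometry.Shioda1982.ExceptionalQuadruplesSweepFiveHundredForty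
import Literature.AlgebraicGeometry.Shioda1982.ExceptionalQuadruplesSweepFiveHundredSixty
import Literature.AlgebraicGeometry.Shioda1982.ExceptionalQuadruplesSweepFiveHundredSixtySeven
import Literature.AlgebraicGeometry.Shioda1982.ExceptionalQuadruplesSweepFiveHundredSeventySix
import Literature.AlgebraicGeometry.Shioda1982.ExceptionalQuadruplesSweepSixHundredThirty
import HarnessLib

/-!
# No exceptional Hodge quadruple at any level `180 < m ≤ 630`, at the prime powers, and at every level with a good prime — the named fact `(𝔅²ₘ) (ii)` reduced to the smooth towers above `630`

Everything PROVED (no named facts, no definitions beyond a private list of levels). The capstone of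
the directory's treatment of [Aoki1983, Thm. C] = [AokiShioda1983, Thm. (𝔅²ₘ) (ii)]
(`HodgeTheory.AokiShioda1983_thmB2m_standard`): [Aoki1983, p. 47] "If `α ∈ 𝔅²ₘ − 𝔇²ₘ`, then
`α ∈ 𝔈²ₘ` or `α ∈ 𝔖²ₘ`. The first case occurs only if `m < 631`" and [MeyerNeutsch1981Fermatquadrupel,
§2, Tabelle 1]: exceptional quadruples ("Ausnahmequadrupel") exist exactly at `22` levels `N ≤ 180`.
HERE:
* **`not_isExceptionalQuadruple_of_lt_631`**: `Δ(m) = 0` for EVERY `180 < m < 631` — the levels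
  with a good prime (`p ≥ 11`, or `p ∈ {5,7}` with `p² ∣ m`) by `not_isExceptionalQuadruple_of_goodPrime`
  (`StandardQuadrupleGoodPrime`, the assembly of the eleven families K₂ … K₇₂), the prime powers
  `243, 256, 512` by `not_isExceptionalQuadruple_two_pow` / `…_three_pow` (`StandardQuadruplePrimePower`), and the remaining `29` levels
  `189, 192, 210, 216, 224, 240, 252, 270, 280, 288, 315, 320, 324, 336, 360, 378, 384, 405, 420, 432,
  448, 480, 486, 504, 540, 560, 567, 576, 630` (the `{2,3,5,7}`-smooth `m` with `25, 49 ∤ m` and two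
  prime factors; `goodPrime_or_residual`, kernel decision) by the kernel sweeps
  `ExceptionalQuadruplesSweep*` (`not_isExceptionalQuadruple_N`); letter form
  **`thmB2m_standard_of_lt_631`**; with `ExceptionalQuadruplesCompleteLeOneHundredEighty`
  (Tabelle 1 complete for `N ≤ 180`): **`mem_levels_of_isExceptionalQuadruple_of_lt_631`** — the
  levels `< 631` carrying an exceptional quadruple are exactly Meyer–Neutsch's `22` (all `≤ 180`):
  Aoki's computer statement "only if `m < 631`" in its printed range, in the kernel.
* **`AokiShioda1983_thmB2m_standard_of_towers`**: the named fact `AokiShioda1983_thmB2m_standard`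
  (all `m > 180`, `(m, 6) > 1`) FOLLOWS from its restriction to the levels `m > 630` of the form
  `2ᵃ3ᵇ5ᶜ7ᵈ`, `c, d ≤ 1`, with at least two prime factors (no good prime, not a prime power) — in
  print these are covered through Aoki's Thm. D (structure of `𝔅¹ₘ`), absent from the tree. This is
  a proved REDUCTION; the fact itself stays undischarged.

HONEST FRAMING (cell `pub-hfermat`): explicit algebraic cycles for specific Hodge classes on
Fermat/Delsarte varieties; residual open instances listed; no claim on general Hodge. (Surface
classes are algebraic by Lefschetz (1,1); this file is about the combinatorics of `𝔅²ₘ` only and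
names exactly which levels of the printed theorem are not reproduced.)

## References
* [Aoki1983] N. Aoki, Math. Ann. 266 (1983) 23–54 — Thm. C p. 47 ("only if `m < 631`"), §9.
* [AokiShioda1983] N. Aoki, T. Shioda, Progr. Math. 35 (1983) 1–12 — §2 Thm. (𝔅²ₘ) (ii), p. 3.
* [MeyerNeutsch1981Fermatquadrupel] W. Meyer, W. Neutsch, Math. Ann. 256 (1981) 51–62 — §2 p. 53,
  Tabelle 1 p. 54.
* [Shioda1982PicardFermat] T. Shioda, J. Fac. Sci. Univ. Tokyo IA 28 (1982) 725–734 — Lemma 1 p. 728,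
  Prop. 4 (Q′) p. 729, Thm. 6 (b), (c) p. 731.
-/

namespace Literature.AlgebraicGeometry.Shioda1982

open Finset Multiset Literature.AlgebraicGeometry.HodgeTheory Literature.AlgebraicGeometry.HodgeTheory.FermatCharacter

/-! ### The range `180 < m < 631` -/

section UpTo630

set_option maxHeartbeats 0 in
/-- Every `180 < m < 631` has a good prime (`p ∣ m` prime with `p ≥ 11`, or `p ∈ {5, 7}` with
`p² ∣ m`), or is `2⁸, 2⁹, 3⁵`, or is one of the `29` residual levels (the `{2,3,5,7}`-smooth levels in `(180, 630]` with `25, 49 ∤ m` and at least two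
prime factors; kernel decision). [folklore] -/
private theorem goodPrime_or_residual : ∀ m < 631, 180 < m →
    (∃ p < 631, p ∣ m ∧ (11 ≤ p ∨ (5 ≤ p ∧ p ^ 2 ∣ m)) ∧ p.Prime) ∨
      m = 2 ^ 8 ∨ m = 2 ^ 9 ∨ m = 3 ^ 5 ∨
      m ∈ ([189, 192, 210, 216, 224, 240, 252, 270, 280, 288, 315, 320, 324, 336, 360, 378, 384, 405, 420,
        432, 448, 480, 486, 504, 540, 560, 567, 576, 630] : List ℕ) := by
  decide +kernel

/-- **`Δ(m) = 0` for every `180 < m < 631`: there is no exceptional Hodge quadruple at these levels**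
— [Aoki1983, Thm. C]: "`α ∈ 𝔈²ₘ` … only if `m < 631`" together with [MeyerNeutsch1981Fermatquadrupel,
Tabelle 1] (`Δ(N) ≠ 0` only for `N ≤ 180`), here in the kernel: good-prime levels by
`not_isExceptionalQuadruple_of_goodPrime`, `256, 512, 243` by `not_isExceptionalQuadruple_two_pow` /
`…_three_pow`, the `29` residual levels by the kernel sweeps `not_isExceptionalQuadruple_N`.
[cite: Aoki1983, Thm. C, p. 47] [cite: MeyerNeutsch1981Fermatquadrupel, §2 p. 53 ("alle Fermatquadrupel für N ≤ 614 ermittelt"), Tabelle 1 p. 54] -/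
theorem not_isExceptionalQuadruple_of_lt_631 (m : ℕ) [NeZero m] (h180 : 180 < m) (h631 : m < 631)
    (s : Multiset (ZMod m)) : ¬ IsExceptionalQuadruple m s := by
  rcases goodPrime_or_residual m h631 h180 with ⟨p, -, hpm, hbig, hp⟩ | h | h | h | hmem
  · exact not_isExceptionalQuadruple_of_goodPrime m h180 hp hpm hbig s
  · subst h; exact not_isExceptionalQuadruple_two_pow (by norm_num) s
  · subst h; exact not_isExceptionalQuadruple_two_pow (by norm_num) s
  · subst h; exact not_isExceptionalQuadruple_three_pow (by norm_num) s
  · simp only [List.mem_cons, List.not_mem_nil, or_false] at hmem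
    rcases hmem with rfl | rfl | rfl | rfl | rfl | rfl | rfl | rfl | rfl | rfl | rfl | rfl | rfl | rfl | rfl | rfl | rfl | rfl | rfl | rfl | rfl | rfl | rfl | rfl | rfl | rfl | rfl | rfl | rfl
    · exact not_isExceptionalQuadruple_oneHundredEightyNine s
    · exact not_isExceptionalQuadruple_oneHundredNinetyTwo s
    · exact not_isExceptionalQuadruple_twoHundredTen s
    · exact not_isExceptionalQuadruple_twoHundredSixteen s
    · exact not_isExceptionalQuadruple_twoHundredTwentyFour s
    · exact not_isExceptionalQuadruple_twoHundredForty s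
    · exact not_isExceptionalQuadruple_twoHundredFiftyTwo s
    · exact not_isExceptionalQuadruple_twoHundredSeventy s
    · exact not_isExceptionalQuadruple_twoHundredEighty s
    · exact not_isExceptionalQuadruple_twoHundredEightyEight s
    · exact not_isExceptionalQuadruple_threeHundredFifteen s
    · exact not_isExceptionalQuadruple_threeHundredTwenty s
    · exact not_isExceptionalQuadruple_threeHundredTwentyFour s
    · exact not_isExceptionalQuadruple_threeHundredThirtySix s
    · exact not_isExceptionalQuadruple_threeHundredSixty s
    · exact not_isExceptionalQuadruple_threeHundredSeventyEight s
    · exact not_isExceptionalQuadruple_threeHundredEightyFour s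
    · exact not_isExceptionalQuadruple_fourHundredFive s
    · exact not_isExceptionalQuadruple_fourHundredTwenty s
    · exact not_isExceptionalQuadruple_fourHundredThirtyTwo s
    · exact not_isExceptionalQuadruple_fourHundredFortyEight s
    · exact not_isExceptionalQuadruple_fourHundredEighty s
    · exact not_isExceptionalQuadruple_fourHundredEightySix s
    · exact not_isExceptionalQuadruple_fiveHundredFour s
    · exact not_isExceptionalQuadruple_fiveHundredForty s
    · exact not_isExceptionalQuadruple_fiveHundredSixty s
    · exact not_isExceptionalQuadruple_fiveHundredSixtySeven s
    · exact not_isExceptionalQuadruple_fiveHundredSeventySix s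
    · exact not_isExceptionalQuadruple_sixHundredThirty s

/-- **The levels of the exceptional Hodge quadruples below `631` are exactly the `22` levels of
[MeyerNeutsch1981Fermatquadrupel, Tabelle 1]**: an exceptional quadruple of level `2 ≤ N < 631` forces
`N ∈ {12, 14, 15, 18, 20, 21, 24, 28, 30, 36, 40, 42, 48, 60, 66, 72, 78, 84, 90, 120, 156, 180}` (for
`N ≤ 180` the tree's `mem_levels_of_isExceptionalQuadruple_of_le_oneHundredEighty`; for `180 < N < 631`
there is none, `not_isExceptionalQuadruple_of_lt_631`); conversely each of these levels carries one
(`ExceptionalQuadruples.level_<N>`). [Aoki1983, Thm. C]: "`α ∈ 𝔈²ₘ` … only if `m < 631`";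
[Shioda1982PicardFermat, table p. 727].
[cite: MeyerNeutsch1981Fermatquadrupel, Tabelle 1 p. 54] [cite: Aoki1983, Thm. C, p. 47] [cite: Shioda1982PicardFermat, table p. 727] -/
theorem mem_levels_of_isExceptionalQuadruple_of_lt_631 {N : ℕ} [NeZero N] (h2 : 2 ≤ N) (h631 : N < 631)
    {s : Multiset (ZMod N)} (hs : IsExceptionalQuadruple N s) :
    N ∈ [12, 14, 15, 18, 20, 21, 24, 28, 30, 36, 40, 42, 48, 60, 66, 72, 78, 84, 90, 120, 156, 180] := by
  by_cases h180 : N ≤ 180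
  · exact mem_levels_of_isExceptionalQuadruple_of_le_oneHundredEighty h2 h180 hs
  · exact absurd hs (not_isExceptionalQuadruple_of_lt_631 N (by omega) h631 s)

/-- **[AokiShioda1983, Thm. (𝔅²ₘ) (ii)] = [Aoki1983, Thm. C] at every level `180 < m < 631`**, in the
letter of the tree's named fact `HodgeTheory.AokiShioda1983_thmB2m_standard`: every indecomposable
primitive Hodge character of length `4` is a permutation of `αᵢ`, `βᵢ` (`m = 2d`) or `γⱼ` (`m = 3d`)
(from `not_isExceptionalQuadruple_of_lt_631` by `letter_of_forall_not_isExceptionalQuadruple`).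
[cite: AokiShioda1983, §2 Thm. (𝔅²ₘ) (ii) a), b), c), p. 3] [cite: Aoki1983, Thm. C, p. 47] -/
theorem thmB2m_standard_of_lt_631 (m : ℕ) [NeZero m] (h180 : 180 < m) (h631 : m < 631)
    (α : Fin 4 → ZMod m) (hα : IsHodge α) (hind : ∀ i j : Fin 4, i ≠ j → α i + α j ≠ 0)
    (hprim : ∀ g : ℕ, (∀ i, g ∣ (α i).val) → g = 1) :
    ∃ σ : Equiv.Perm (Fin 4),
      (∃ d i : ℕ, m = 2 * d ∧ 1 ≤ i ∧ i < d ∧ Nat.Coprime i d ∧ 4 * i ≠ m ∧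
          ∀ k, α (σ k) = ![(i : ZMod m), (d : ZMod m) + i, -(2 * (i : ZMod m)), (d : ZMod m)] k) ∨
      (∃ d i : ℕ, m = 2 * d ∧ 1 ≤ i ∧ i < d ∧ Nat.Coprime i d ∧ 3 * i ≠ m ∧ 4 * i ≠ m ∧ 6 * i ≠ m ∧
          ∀ k, α (σ k) =
            ![(i : ZMod m), (d : ZMod m) + i, (d : ZMod m) + 2 * i, -(4 * (i : ZMod m))] k) ∨
      (∃ d j : ℕ, m = 3 * d ∧ 1 ≤ j ∧ j < d ∧ Nat.Coprime j d ∧ 6 * j ≠ m ∧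
          ∀ k, α (σ k) =
            ![(j : ZMod m), (d : ZMod m) + j, 2 * (d : ZMod m) + j, -(3 * (j : ZMod m))] k) :=
  letter_of_forall_not_isExceptionalQuadruple (not_isExceptionalQuadruple_of_lt_631 m h180 h631)
    α hα hind hprim

/-- **The named fact `AokiShioda1983_thmB2m_standard` reduces to the smooth towers above `630`.**
If the letter of [AokiShioda1983, Thm. (𝔅²ₘ) (ii)] holds at every level `m > 630` with
`(m, 6) > 1`, all prime factors `≤ 7`, `25 ∤ m`, `49 ∤ m`, and `m` not a power of `2` or `3` — the
levels `2ᵃ3ᵇ5ᶜ7ᵈ > 630`, `c, d ≤ 1`, with two prime factors (`648, 640, 672, 720, 756, …`) —, then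
it holds at every level `m > 180`: `m < 631` is `thmB2m_standard_of_lt_631`, the good-prime levels
and the prime powers are `AokiShioda1983_thmB2m_standard_of_smooth` (`StandardQuadrupleGoodPrime`).
A proved REDUCTION, not a discharge; the hypothesis is the part of [Aoki1983, Thm. C] resting on
Aoki's Thm. D (structure of `𝔅¹ₘ`), which the tree does not have.
[cite: AokiShioda1983, §2 Thm. (𝔅²ₘ) (ii), p. 3] [cite: Aoki1983, Thm. C, p. 47] -/
theorem AokiShioda1983_thmB2m_standard_of_towers
    (htowers : ∀ (m : ℕ) [NeZero m], 1 < Nat.gcd m 6 → 630 < m →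
      (∀ p : ℕ, p.Prime → p ∣ m → p ≤ 7) → ¬ 25 ∣ m → ¬ 49 ∣ m →
      (∀ k : ℕ, m ≠ 2 ^ k) → (∀ k : ℕ, m ≠ 3 ^ k) →
      ∀ α : Fin 4 → ZMod m, IsHodge α →
        (∀ i j : Fin 4, i ≠ j → α i + α j ≠ 0) →
        (∀ g : ℕ, (∀ i, g ∣ (α i).val) → g = 1) →
    ∃ σ : Equiv.Perm (Fin 4),
      (∃ d i : ℕ, m = 2 * d ∧ 1 ≤ i ∧ i < d ∧ Nat.Coprime i d ∧ 4 * i ≠ m ∧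
          ∀ k, α (σ k) = ![(i : ZMod m), (d : ZMod m) + i, -(2 * (i : ZMod m)), (d : ZMod m)] k) ∨
      (∃ d i : ℕ, m = 2 * d ∧ 1 ≤ i ∧ i < d ∧ Nat.Coprime i d ∧ 3 * i ≠ m ∧ 4 * i ≠ m ∧ 6 * i ≠ m ∧
          ∀ k, α (σ k) =
            ![(i : ZMod m), (d : ZMod m) + i, (d : ZMod m) + 2 * i, -(4 * (i : ZMod m))] k) ∨
      (∃ d j : ℕ, m = 3 * d ∧ 1 ≤ j ∧ j < d ∧ Nat.Coprime j d ∧ 6 * j ≠ m ∧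
          ∀ k, α (σ k) =
            ![(j : ZMod m), (d : ZMod m) + j, 2 * (d : ZMod m) + j, -(3 * (j : ZMod m))] k)) :
    AokiShioda1983_thmB2m_standard :=
  AokiShioda1983_thmB2m_standard_of_smooth fun m _ h6 h180 hsm h25 h49 h2k h3k α hα hind hprim ↦ by
    by_cases h631 : m < 631
    · exact thmB2m_standard_of_lt_631 m h180 h631 α hα hind hprim
    · exact htowers m h6 (by omega) hsm h25 h49 h2k h3k α hα hind hprim

end UpTo630

end Literature.AlgebraicGeometry.Shioda1982
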